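import Summits.QuantumFields.YangMills.Theorems.LuscherReductionTwistedTraceScalingBTColourMean
import Summits.QuantumFields.YangMills.Theorems.LuscherReductionTwistedTraceScalingSlowShadow
import HarnessLib

/-!
# The colour-localised BO kernel is INVARIANT under the global colour rotation of both slow data: `fpBOKernel(cuc⁻¹, cu'c⁻¹) = fpBOKernel(u, u')`
# (lane A of S-BASE, crux `TwistedTraceScaling` stmt-QuantumFields-20203, C4-CORE, the (B-T) pen (B); design note `pub/ym-fleet/ym-luscher-20007-p1/COARSE-DESIGN.md` §25.7 (L3))

The diagonal factor `f(u) = fpBOKernel(u,u)/K₁(u,u)` of the Laplace core is compared with `f(1)` after averaging over `u ↦ cuc⁻¹` (`…BTColourAveraging`); this needs `f(cuc⁻¹) = f(u)`.  Here the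
numerator: for colour-blind `Ω` and the weight of record `fpWeight ε` (indeed any CONJUGATION-invariant weight),
★★ `fpBOKernel_conj`: `fpBOKernel β Ω W (cuc⁻¹) (cu'c⁻¹) = fpBOKernel β Ω W u u'` — three invariant substitutions and no Fubini: `v ↦ Ad_c v`, `v' ↦ Ad_c v'` (`integral_orthoTransverse_colourRotate`,
`R33.gaugeTransform_const_orthoTube`), `g ↦ cgc⁻¹` (left and right invariance of the gauge-group Haar measure), `K(Ad_cU, Ad_c(V^g)) = K(U, V^g)`.  Ingredients: `colourMean_conj`
(`colourMean (cgc⁻¹) = c·colourMean g·c⁻¹`), `fpWeight_conj`; and the one-site side `transferKernel_conj_conj` (`K₁(cuc⁻¹, cu'c⁻¹) = K₁(u,u')`).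
HONEST FRAMING: symmetry bookkeeping for a stub of a child of the CONDITIONAL reduction route R2b1; the Laplace core of (B-T) is OPEN; C4-CORE OPEN; not infinite volume, not a gap, not Clay.
-/

set_option autoImplicit false

noncomputable section

open MeasureTheory Filter Topology Real
open scoped BigOperators Quaternion
open Literature.MathematicalPhysics.QuantumFieldTheory
open Literature.MathematicalPhysics.QuantumLattice

namespace Summit.QuantumFields.YangMills.Theorems.FemtoTransferGap.TwoLattice.ConstTube

open Summit.QuantumFields.YangMills.Theorems.FemtoTransferGap
open Summit.QuantumFields.YangMills.Theorems.FemtoTransferGap.TwoLattice.Avg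
open Summit.QuantumFields.YangMills.Theorems.FemtoTransferGap.TwoLattice.Stiff (LinkSpace)

variable {L : ℕ} [NeZero L]

/-! ## §1 Conjugation of the colour mean and of the weight -/

/-- `Σ_x q(c g_x c⁻¹) = q(c)·(Σ_x q(g_x))·q(c)⁻¹`. [folklore] -/
theorem colourQuatSum_conj (c : SU2) (g : Site 3 L → SU2) :
    colourQuatSum L (fun x => c * g x * c⁻¹) = su2Quat c * colourQuatSum L g * (su2Quat c)⁻¹ := by
  unfold colourQuatSum
  rw [Finset.mul_sum, Finset.sum_mul]
  refine Finset.sum_congr rfl fun x _ => ?_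
  rw [Literature.MathematicalPhysics.QuantumFieldTheory.Balaban1983to89.T4HaarSU2Translate.su2Quat_mul,
    Literature.MathematicalPhysics.QuantumFieldTheory.Balaban1983to89.T4HaarSU2Translate.su2Quat_mul, su2Quat_inv']

/-- ★ **The colour mean is conjugation equivariant**: `colourMean (cgc⁻¹) = c·colourMean g·c⁻¹`. [folklore] -/
theorem colourMean_conj (c : SU2) (g : Site 3 L → SU2) : colourMean L (fun x => c * g x * c⁻¹) = c * colourMean L g * c⁻¹ := by
  unfold colourMean
  rw [colourQuatSum_conj]
  have hq : su2Quat c ≠ 0 := su2Quat_ne_zero c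
  have hqi : (su2Quat c)⁻¹ ≠ 0 := inv_ne_zero hq
  by_cases h : colourQuatSum L g = 0
  · rw [if_pos h, if_pos (by rw [h, mul_zero, zero_mul])]
  · have hne : su2Quat c * colourQuatSum L g * (su2Quat c)⁻¹ ≠ 0 := mul_ne_zero (mul_ne_zero hq h) hqi
    rw [if_neg h, if_neg hne, ← su2Quat_inv', quatToSU2_mul_su2Quat (mul_ne_zero hq h) c⁻¹, ← mul_quatToSU2 c h]

/-- The colour ball is conjugation invariant. [folklore] -/
theorem conj_mem_fpBall_iff (ε : ℝ) (c m : SU2) : c * m * c⁻¹ ∈ fpBall ε ↔ m ∈ fpBall ε := by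
  unfold fpBall
  simp only [Set.mem_setOf_eq]
  have h : su2Quat (c * m * c⁻¹) - 1 = su2Quat c * (su2Quat m - 1) * (su2Quat c)⁻¹ := by
    rw [Literature.MathematicalPhysics.QuantumFieldTheory.Balaban1983to89.T4HaarSU2Translate.su2Quat_mul,
      Literature.MathematicalPhysics.QuantumFieldTheory.Balaban1983to89.T4HaarSU2Translate.su2Quat_mul, su2Quat_inv', mul_sub, sub_mul, mul_one,
      mul_inv_cancel₀ (su2Quat_ne_zero c)]
  rw [h, norm_mul, norm_mul, norm_inv, norm_su2Quat, one_mul, inv_one, mul_one]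

/-- ★ **The weight of record is conjugation invariant**: `fpWeight ε (cgc⁻¹) = fpWeight ε g`. [folklore] -/
theorem fpWeight_conj (ε : ℝ) (c : SU2) (g : Site 3 L → SU2) : fpWeight L ε (fun x => c * g x * c⁻¹) = fpWeight L ε g := by
  unfold fpWeight
  rw [colourMean_conj]
  by_cases h : colourMean L g ∈ fpBall ε
  · rw [Set.indicator_of_mem h, Set.indicator_of_mem ((conj_mem_fpBall_iff ε c _).mpr h)]
  · rw [Set.indicator_of_notMem h, Set.indicator_of_notMem (fun h' => h ((conj_mem_fpBall_iff ε c _).mp h'))]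

/-! ## §2 Conjugation inside the kernel -/

omit [NeZero L] in
/-- `(cgc⁻¹)·(Ad_c V) = Ad_c(g·V)`. [folklore] -/
theorem gaugeTransform_conj_gaugeTransform_const (c : SU2) (g : Site 3 L → SU2) (V : GaugeConfig 3 L SU2) :
    gaugeTransform (fun x => c * g x * c⁻¹) (gaugeTransform (fun _ : Site 3 L => c) V) = gaugeTransform (fun _ : Site 3 L => c) (gaugeTransform g V) := by
  rw [gaugeTransform_gaugeTransform, gaugeTransform_gaugeTransform]
  congr 1
  funext x
  simp [Pi.mul_apply]

/-- The one-site kernel is invariant under simultaneous conjugation. [folklore] -/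
theorem transferKernel_conj_conj {M : ℕ} [NeZero M] (β : ℝ) (c : SU2) (u u' : GaugeConfig 3 M SU2) :
    transferKernel su2Rep β (gaugeTransform (fun _ : Site 3 M => c) u) (gaugeTransform (fun _ : Site 3 M => c) u') = transferKernel su2Rep β u u' :=
  transferKernel_gaugeTransform su2Rep β _ u u'

/-! ## §3 ★★ Invariance of the colour-localised BO kernel -/

/-- ★★ **`fpBOKernel β Ω W (cuc⁻¹) (cu'c⁻¹) = fpBOKernel β Ω W u u'`** for colour-blind measurable `Ω` and any conjugation-invariant weight `W`. [cite: Luscher1983, §3] -/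
theorem fpBOKernel_conj (β : ℝ) {Ω : LinkSpace L → ℝ} (hΩm : Measurable Ω) (hΩinv : ∀ (g : SU2) (x : LinkSpace L), Ω (adL L g x) = Ω x)
    {W : (Site 3 L → SU2) → ℝ} (hW : Measurable W) (hWinv : ∀ (c : SU2) (g : Site 3 L → SU2), W (fun x => c * g x * c⁻¹) = W g) (c : SU2) (u u' : GaugeConfig 3 1 SU2) :
    fpBOKernel L β Ω W (gaugeTransform (fun _ : Site 3 1 => c) u) (gaugeTransform (fun _ : Site 3 1 => c) u') = fpBOKernel L β Ω W u u' := by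
  haveI : SecondCountableTopology SU2 := secondCountableTopology_su2
  haveI := isFiniteMeasure_orthoTransverse L
  -- the `g`-integral at conjugated tube points equals the one at the original points (g ↦ cgc⁻¹)
  have hg : ∀ U V : GaugeConfig 3 L SU2,
      ∫ g, W g * transferKernel su2Rep β (gaugeTransform (fun _ : Site 3 L => c) U) (gaugeTransform g (gaugeTransform (fun _ : Site 3 L => c) V)) ∂gaugeMeasure L =
        ∫ g, W g * transferKernel su2Rep β U (gaugeTransform g V) ∂gaugeMeasure L := fun U V => by
    have h1 : ∫ g, W g * transferKernel su2Rep β (gaugeTransform (fun _ : Site 3 L => c) U) (gaugeTransform g (gaugeTransform (fun _ : Site 3 L => c) V)) ∂gaugeMeasure L =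
        ∫ g, W ((fun _ : Site 3 L => c) * g) * transferKernel su2Rep β (gaugeTransform (fun _ : Site 3 L => c) U)
          (gaugeTransform ((fun _ : Site 3 L => c) * g) (gaugeTransform (fun _ : Site 3 L => c) V)) ∂gaugeMeasure L :=
      (integral_mul_left_eq_self (μ := gaugeMeasure L)
        (fun g : Site 3 L → SU2 => W g * transferKernel su2Rep β (gaugeTransform (fun _ : Site 3 L => c) U) (gaugeTransform g (gaugeTransform (fun _ : Site 3 L => c) V)))
        (fun _ => c)).symm
    have h2 : ∫ g, W ((fun _ : Site 3 L => c) * g) * transferKernel su2Rep β (gaugeTransform (fun _ : Site 3 L => c) U)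
          (gaugeTransform ((fun _ : Site 3 L => c) * g) (gaugeTransform (fun _ : Site 3 L => c) V)) ∂gaugeMeasure L =
        ∫ g, W ((fun _ : Site 3 L => c) * (g * fun _ : Site 3 L => c⁻¹)) * transferKernel su2Rep β (gaugeTransform (fun _ : Site 3 L => c) U)
          (gaugeTransform ((fun _ : Site 3 L => c) * (g * fun _ : Site 3 L => c⁻¹)) (gaugeTransform (fun _ : Site 3 L => c) V)) ∂gaugeMeasure L :=
      (integral_mul_right_eq_self (μ := gaugeMeasure L)
        (fun g : Site 3 L → SU2 => W ((fun _ : Site 3 L => c) * g) * transferKernel su2Rep β (gaugeTransform (fun _ : Site 3 L => c) U)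
          (gaugeTransform ((fun _ : Site 3 L => c) * g) (gaugeTransform (fun _ : Site 3 L => c) V))) (fun _ => c⁻¹)).symm
    rw [h1, h2]
    refine integral_congr_ae (ae_of_all _ fun g => ?_)
    dsimp only
    have e : ((fun _ : Site 3 L => c) * (g * fun _ : Site 3 L => c⁻¹)) = fun x => c * g x * c⁻¹ := by funext x; simp [Pi.mul_apply, mul_assoc]
    rw [e, hWinv, gaugeTransform_conj_gaugeTransform_const, transferKernel_conj_conj]
  -- pointwise identity of the `v`-integrands on the cap, after rotating `v, v'`
  have hcap : ∀ᵐ v ∂orthoTransverse L, v ∈ capBalancedSet L := by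
    rw [ae_iff]
    have h0 := orthoTransverse_compl_capBalancedSet L
    simpa only [Set.compl_def] using h0
  -- measurability of the two one-variable integrands
  have hΨm : ∀ uu uu' : GaugeConfig 3 1 SU2, Measurable fun w : Edge 3 L → Fin 3 → ℝ => Ω (linkEmbed L w) *
      ∫ v', (∫ g, W g * transferKernel su2Rep β (orthoTube L uu w) (gaugeTransform g (orthoTube L uu' v')) ∂gaugeMeasure L) * Ω (linkEmbed L v') ∂orthoTransverse L := by
    intro uu uu'
    have h4 := measurable_fp_integrand (L := L) β hW uu uu'
    have hG' := (h4.stronglyMeasurable.integral_prod_right' (ν := gaugeMeasure L)).measurable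
    have hG'' : Measurable fun t : ((Edge 3 L → Fin 3 → ℝ) × (Edge 3 L → Fin 3 → ℝ)) × SU2 =>
        ∫ g, W g * transferKernel su2Rep β (gaugeTransform (fun _ : Site 3 L => t.2⁻¹) (orthoTube L uu t.1.1)) (gaugeTransform g (orthoTube L uu' t.1.2)) ∂gaugeMeasure L := by
      simpa only using hG'
    have hsec : Measurable fun r : (Edge 3 L → Fin 3 → ℝ) × (Edge 3 L → Fin 3 → ℝ) =>
        (∫ g, W g * transferKernel su2Rep β (gaugeTransform (fun _ : Site 3 L => (1 : SU2)⁻¹) (orthoTube L uu r.1)) (gaugeTransform g (orthoTube L uu' r.2)) ∂gaugeMeasure L) *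
          Ω (linkEmbed L r.2) := by
      have hp : Measurable fun r : (Edge 3 L → Fin 3 → ℝ) × (Edge 3 L → Fin 3 → ℝ) => ((r, (1 : SU2)) : ((Edge 3 L → Fin 3 → ℝ) × (Edge 3 L → Fin 3 → ℝ)) × SU2) :=
        measurable_id.prodMk measurable_const
      have h := hG''.comp hp
      have h' : Measurable fun r : (Edge 3 L → Fin 3 → ℝ) × (Edge 3 L → Fin 3 → ℝ) =>
          ∫ g, W g * transferKernel su2Rep β (gaugeTransform (fun _ : Site 3 L => (1 : SU2)⁻¹) (orthoTube L uu r.1)) (gaugeTransform g (orthoTube L uu' r.2)) ∂gaugeMeasure L := by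
        simpa only [Function.comp_def] using h
      exact h'.mul (hΩm.comp ((measurable_linkEmbed L).comp measurable_snd))
    have hone : ∀ U : GaugeConfig 3 L SU2, gaugeTransform (fun _ : Site 3 L => (1 : SU2)⁻¹) U = U := fun U => by
      rw [inv_one]; exact TT.gaugeTransform_one' U
    simp only [hone] at hsec
    have hI := (hsec.stronglyMeasurable.integral_prod_right' (ν := orthoTransverse L)).measurable
    have hI' : Measurable fun w : Edge 3 L → Fin 3 → ℝ =>
        ∫ v', (∫ g, W g * transferKernel su2Rep β (orthoTube L uu w) (gaugeTransform g (orthoTube L uu' v')) ∂gaugeMeasure L) * Ω (linkEmbed L v') ∂orthoTransverse L := by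
      simpa only using hI
    exact (hΩm.comp (measurable_linkEmbed L)).mul hI'
  have hΦm : ∀ (U : GaugeConfig 3 L SU2) (uu' : GaugeConfig 3 1 SU2), Measurable fun w' : Edge 3 L → Fin 3 → ℝ =>
      (∫ g, W g * transferKernel su2Rep β U (gaugeTransform g (orthoTube L uu' w')) ∂gaugeMeasure L) * Ω (linkEmbed L w') := by
    intro U uu'
    have hK : Measurable fun p : (Edge 3 L → Fin 3 → ℝ) × (Site 3 L → SU2) => W p.2 * transferKernel su2Rep β U (gaugeTransform p.2 (orthoTube L uu' p.1)) := by
      have ha : Measurable fun p : (Edge 3 L → Fin 3 → ℝ) × (Site 3 L → SU2) => (orthoTube L uu' p.1, p.2) :=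
        ((measurable_orthoTube_right (L := L) _).comp measurable_fst).prodMk measurable_snd
      have h := ((continuous_transferKernel_right β U).measurable.comp ((measurable_gaugeAction (L := L)).comp ha))
      exact (hW.comp measurable_snd).mul (by simpa only [Function.comp_def] using h)
    have h := (hK.stronglyMeasurable.integral_prod_right' (ν := gaugeMeasure L)).measurable
    have h' : Measurable fun w' : Edge 3 L → Fin 3 → ℝ => ∫ g, W g * transferKernel su2Rep β U (gaugeTransform g (orthoTube L uu' w')) ∂gaugeMeasure L := by
      simpa only using h
    exact h'.mul (hΩm.comp (measurable_linkEmbed L))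
  set uc : GaugeConfig 3 1 SU2 := gaugeTransform (fun _ : Site 3 1 => c) u with huc
  set uc' : GaugeConfig 3 1 SU2 := gaugeTransform (fun _ : Site 3 1 => c) u' with huc'
  unfold fpBOKernel
  -- Step A: rotate the outer variable
  have hA := integral_orthoTransverse_colourRotate L (fun _ => c) _ (hΨm uc uc')
  refine hA.symm.trans ?_
  refine integral_congr_ae ?_
  filter_upwards [hcap] with v hv
  have hv1 : ∀ e : Edge 3 L, ∑ a, v e a ^ 2 ≤ 1 := sum_sq_le_one_of_cap L hv.2
  rw [linkEmbed_colourRotate_const, hΩinv]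
  refine congrArg (fun t : ℝ => Ω (linkEmbed L v) * t) ?_
  -- Step B: rotate the inner variable
  have hB := integral_orthoTransverse_colourRotate L (fun _ => c) _ (hΦm (orthoTube L uc (colourRotate L (fun _ => c) v)) uc')
  refine hB.symm.trans ?_
  refine integral_congr_ae ?_
  filter_upwards [hcap] with v' hv'
  have hv1' : ∀ e : Edge 3 L, ∑ a, v' e a ^ 2 ≤ 1 := sum_sq_le_one_of_cap L hv'.2
  rw [linkEmbed_colourRotate_const, hΩinv]
  refine congrArg (fun t : ℝ => t * Ω (linkEmbed L v')) ?_
  -- Step C: both tube points are conjugates; the `g`-integral is invariant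
  rw [huc, huc', ← Summit.QuantumFields.YangMills.Theorems.TwistedTraceScaling.Negative.R33.gaugeTransform_const_orthoTube c u hv1,
    ← Summit.QuantumFields.YangMills.Theorems.TwistedTraceScaling.Negative.R33.gaugeTransform_const_orthoTube c u' hv1', hg]

end Summit.QuantumFields.YangMills.Theorems.FemtoTransferGap.TwoLattice.ConstTube

end
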